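import Summits.CriticalPhenomena.PercolationContinuityZ3.Theorems.PercNearOneGluingNoHeavyLowerTailSahiStrongCubicMax
import Mathlib.Tactic.Linarith
import Mathlib.Tactic.Ring
import HarnessLib

/-!
# `NoHeavyLowerTail` (crux stmt-CriticalPhenomena-4575), master-family line P1 (gen 16):
# the one-payer functional for three INDEPENDENT events — the outside pays EXACTLY (`e₃ = o·G`), closed form and equality case

Support file (seat `prim-masterthm-p1`, gen 16; `--supports stmt-CriticalPhenomena-4575`).  Pure proof file, no `sorry`, standard axioms.
Memo `run/shared/lean/prim/prim-masterthm/FROM-prim-masterthm-p1-g16-ONE-PAYER.md` §0(ii), §3.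

SETTING (tree `SahiDeepCore`): cells `α, β, d` (only `G₂` / only `G₁` / only `G₃`), core `κ` ("≥ 2 of the `G_i`"), outside `o` ("none") of the
co-sunflower `(G₂∪G₃, G₁∪G₃, G₁∪G₂)`; `G = κo − e₂` (`gladkovDefect`), `strongCubicMax = max(κ,o)·G − e₃`; conjecture `StrongCubicMaxNonneg`.

NEW HERE (all [this work]).  If the three events are (mutually) INDEPENDENT under the product weight — the four product identities
`μ(G_i ∩ G_j) = μ(G_i)μ(G_j)`, `μ(G₁∩G₂∩G₃) = μ(G₁)μ(G₂)μ(G₃)` taken as hypotheses (they hold e.g. for increasing events determined by pairwise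
disjoint coordinate sets; no monotonicity is needed here) — then with `P_i = μ(G_i)`, `Q_i = 1 − P_i`:
* `cells_of_independent`: `o = Q₁Q₂Q₃`, `α = P₂Q₁Q₃`, `β = P₁Q₂Q₃`, `d = P₃Q₁Q₂` (inclusion–exclusion on indicators);
* `gladkovDefect_of_independent`: **`G = P₁P₂P₃·Q₁Q₂Q₃`** — the standard-system identity `G = μ(top)μ(bottom)` at biases `P_i`;
* `outsidePays_of_independent`: **`e₃ = o·G`** — the outside pays for all rainbows EXACTLY;
* `strongCubicMax_of_independent`: **`strongCubicMax = (max(κ,o) − o)·(P₁P₂P₃Q₁Q₂Q₃)`**, hence `strongCubicMax_nonneg_of_independent` (S₃^max holds, any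
  three independent events) and `strongCubicMax_eq_zero_of_independent` (**equality whenever `κ ≤ o`**).
This is the mass-level content of the block calculus for std3 (memo §3: every 3-block composite std3∘(c₁,c₂,c₃) is a triple of independent events) and it
generalises the OR-block sharpness file `…SahiStrongCubicMaxSharp` to arbitrary independent generators: the factor `max(κ,o)` in the one-payer conjecture is
attained with equality on the whole region `{κ ≤ o}` of every independent triple.
-/

noncomputable section

open scoped Classical

namespace Summit.CriticalPhenomena.PercolationContinuityZ3.Theorems

namespace SahiDeepCore

open Literature.Combinatorics.Sahi2008
open Literature.Probability.Percolation.DecisionTree (ind ind_of_mem ind_of_not_mem ind_nonneg)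

variable {ι : Type} [Fintype ι]

local notation3 (prettyPrint := false) "m⟦" p ", " X "⟧" => ex (bernoulliWeight p) (ind X)

/-! ### 1. Inclusion–exclusion for the cells of a co-sunflower -/

omit [Fintype ι] in
/-- Pointwise inclusion–exclusion for a private part: `1_{G₁} + 1_{G₁∩G₂∩G₃} = 1_{G₁∖(G₂∪G₃)} + 1_{G₁∩G₂} + 1_{G₁∩G₃}`. [folklore] -/
private theorem ind_only (G₁ G₂ G₃ : Set (Set ι)) :
    ind G₁ + ind (G₁ ∩ G₂ ∩ G₃) = ind (G₁ \ (G₂ ∪ G₃)) + ind (G₁ ∩ G₂) + ind (G₁ ∩ G₃) := by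
  funext ω
  simp only [Pi.add_apply]
  by_cases h1 : ω ∈ G₁
  · by_cases h2 : ω ∈ G₂ <;> by_cases h3 : ω ∈ G₃
    · rw [ind_of_mem h1, ind_of_mem (show ω ∈ G₁ ∩ G₂ ∩ G₃ from ⟨⟨h1, h2⟩, h3⟩),
        ind_of_not_mem (show ω ∉ G₁ \ (G₂ ∪ G₃) from fun h => h.2 (Or.inl h2)),
        ind_of_mem (show ω ∈ G₁ ∩ G₂ from ⟨h1, h2⟩), ind_of_mem (show ω ∈ G₁ ∩ G₃ from ⟨h1, h3⟩)]; norm_num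
    · rw [ind_of_mem h1, ind_of_not_mem (show ω ∉ G₁ ∩ G₂ ∩ G₃ from fun h => h3 h.2),
        ind_of_not_mem (show ω ∉ G₁ \ (G₂ ∪ G₃) from fun h => h.2 (Or.inl h2)),
        ind_of_mem (show ω ∈ G₁ ∩ G₂ from ⟨h1, h2⟩), ind_of_not_mem (show ω ∉ G₁ ∩ G₃ from fun h => h3 h.2)]; norm_num
    · rw [ind_of_mem h1, ind_of_not_mem (show ω ∉ G₁ ∩ G₂ ∩ G₃ from fun h => h2 h.1.2),
        ind_of_not_mem (show ω ∉ G₁ \ (G₂ ∪ G₃) from fun h => h.2 (Or.inr h3)),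
        ind_of_not_mem (show ω ∉ G₁ ∩ G₂ from fun h => h2 h.2), ind_of_mem (show ω ∈ G₁ ∩ G₃ from ⟨h1, h3⟩)]; norm_num
    · rw [ind_of_mem h1, ind_of_not_mem (show ω ∉ G₁ ∩ G₂ ∩ G₃ from fun h => h2 h.1.2),
        ind_of_mem (show ω ∈ G₁ \ (G₂ ∪ G₃) from ⟨h1, fun h => h.elim h2 h3⟩),
        ind_of_not_mem (show ω ∉ G₁ ∩ G₂ from fun h => h2 h.2), ind_of_not_mem (show ω ∉ G₁ ∩ G₃ from fun h => h3 h.2)]; norm_num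
  · rw [ind_of_not_mem h1, ind_of_not_mem (show ω ∉ G₁ ∩ G₂ ∩ G₃ from fun h => h1 h.1.1),
      ind_of_not_mem (show ω ∉ G₁ \ (G₂ ∪ G₃) from fun h => h1 h.1),
      ind_of_not_mem (show ω ∉ G₁ ∩ G₂ from fun h => h1 h.1), ind_of_not_mem (show ω ∉ G₁ ∩ G₃ from fun h => h1 h.1)]; norm_num

omit [Fintype ι] in
/-- Pointwise inclusion–exclusion for the outside: `1_{(G₁∪G₂∪G₃)ᶜ} + 1_{G₁} + 1_{G₂} + 1_{G₃} + 1_{G₁∩G₂∩G₃} = 1 + 1_{G₁∩G₂} + 1_{G₁∩G₃} + 1_{G₂∩G₃}`. [folklore] -/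
private theorem ind_none (G₁ G₂ G₃ : Set (Set ι)) :
    ind (G₁ ∪ G₂ ∪ G₃)ᶜ + ind G₁ + ind G₂ + ind G₃ + ind (G₁ ∩ G₂ ∩ G₃) =
      (fun _ => (1 : ℝ)) + ind (G₁ ∩ G₂) + ind (G₁ ∩ G₃) + ind (G₂ ∩ G₃) := by
  funext ω
  simp only [Pi.add_apply]
  by_cases h1 : ω ∈ G₁ <;> by_cases h2 : ω ∈ G₂ <;> by_cases h3 : ω ∈ G₃ <;>
    simp only [h1, h2, h3, ind_of_mem, ind_of_not_mem, Set.mem_compl_iff, Set.mem_union, Set.mem_inter_iff, not_true,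
      not_false_eq_true, or_self, or_true, or_false, and_self, and_true, and_false] <;> norm_num

/-- Masses are at most one. [folklore] -/
private theorem massInd_le_one (p : ι → unitInterval) (X : Set (Set ι)) : m⟦p, X⟧ ≤ 1 := by
  have e : ind X + ind Xᶜ = fun _ => (1 : ℝ) := by
    funext ω; simp only [Pi.add_apply]
    by_cases h : ω ∈ X
    · rw [ind_of_mem h, ind_of_not_mem (show ω ∉ Xᶜ from fun h' => h' h)]; norm_num
    · rw [ind_of_not_mem h, ind_of_mem (show ω ∈ Xᶜ from h)]; norm_num
  have h := congrArg (ex (bernoulliWeight p)) e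
  rw [ex_add, ex_const (sum_bernoulliWeight p)] at h
  have h0 : 0 ≤ m⟦p, Xᶜ⟧ := ex_nonneg (isFKGMeasure_bernoulliWeight p).nonneg fun ω => ind_nonneg _ ω
  linarith

/-- Masses are nonnegative. [folklore] -/
private theorem massInd_nonneg (p : ι → unitInterval) (X : Set (Set ι)) : 0 ≤ m⟦p, X⟧ :=
  ex_nonneg (isFKGMeasure_bernoulliWeight p).nonneg fun ω => ind_nonneg _ ω

/-- **Cells of the co-sunflower of three INDEPENDENT events** (product identities as hypotheses): outside `Q₁Q₂Q₃` and petals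
`P₂Q₁Q₃` (`A∖B` = only `G₂`), `P₁Q₂Q₃` (only `G₁`), `P₃Q₁Q₂` (only `G₃`). [this work] -/
theorem cells_of_independent (p : ι → unitInterval) {G₁ G₂ G₃ : Set (Set ι)}
    (h12 : m⟦p, G₁ ∩ G₂⟧ = m⟦p, G₁⟧ * m⟦p, G₂⟧) (h13 : m⟦p, G₁ ∩ G₃⟧ = m⟦p, G₁⟧ * m⟦p, G₃⟧)
    (h23 : m⟦p, G₂ ∩ G₃⟧ = m⟦p, G₂⟧ * m⟦p, G₃⟧) (h123 : m⟦p, G₁ ∩ G₂ ∩ G₃⟧ = m⟦p, G₁⟧ * m⟦p, G₂⟧ * m⟦p, G₃⟧) :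
    m⟦p, ((G₂ ∪ G₃) ∪ (G₁ ∪ G₃))ᶜ⟧ = (1 - m⟦p, G₁⟧) * (1 - m⟦p, G₂⟧) * (1 - m⟦p, G₃⟧) ∧
      m⟦p, (G₂ ∪ G₃) \ (G₁ ∪ G₃)⟧ = m⟦p, G₂⟧ * (1 - m⟦p, G₁⟧) * (1 - m⟦p, G₃⟧) ∧
      m⟦p, (G₁ ∪ G₃) \ (G₂ ∪ G₃)⟧ = m⟦p, G₁⟧ * (1 - m⟦p, G₂⟧) * (1 - m⟦p, G₃⟧) ∧
      m⟦p, ((G₂ ∪ G₃) ∩ (G₁ ∪ G₃)) \ (G₁ ∪ G₂)⟧ = m⟦p, G₃⟧ * (1 - m⟦p, G₁⟧) * (1 - m⟦p, G₂⟧) := by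
  obtain ⟨e3, e2, e1⟩ := coSunflower_privateParts G₁ G₂ G₃
  obtain ⟨-, hout⟩ := coSunflower_coreOutside G₁ G₂ G₃
  -- only G₁
  have o1 := congrArg (ex (bernoulliWeight p)) (ind_only G₁ G₂ G₃)
  rw [ex_add, ex_add, ex_add, h123, h12, h13] at o1
  -- only G₂ (inclusion–exclusion with the roles of G₁, G₂ swapped)
  have o2 := congrArg (ex (bernoulliWeight p)) (ind_only G₂ G₁ G₃)
  rw [ex_add, ex_add, ex_add, Set.inter_comm G₂ G₁, h12, h23] at o2
  have h213 : m⟦p, G₁ ∩ G₂ ∩ G₃⟧ = m⟦p, G₁⟧ * m⟦p, G₂⟧ * m⟦p, G₃⟧ := h123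
  rw [h213] at o2
  -- only G₃
  have o3 := congrArg (ex (bernoulliWeight p)) (ind_only G₃ G₁ G₂)
  have hset : G₃ ∩ G₁ ∩ G₂ = G₁ ∩ G₂ ∩ G₃ := by ext ω; simp only [Set.mem_inter_iff]; tauto
  rw [ex_add, ex_add, ex_add, hset, h123, Set.inter_comm G₃ G₁, h13, Set.inter_comm G₃ G₂, h23] at o3
  -- none
  have o0 := congrArg (ex (bernoulliWeight p)) (ind_none G₁ G₂ G₃)
  rw [ex_add, ex_add, ex_add, ex_add, ex_add, ex_add, ex_add, ex_const (sum_bernoulliWeight p), h12, h13, h23, h123] at o0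
  refine ⟨?_, ?_, ?_, ?_⟩
  · rw [hout]; linarith
  · rw [e2]; linarith
  · rw [e1]; linarith
  · rw [e3]; linarith

/-- **Gladkov's defect of three independent events**: `G = P₁P₂P₃·Q₁Q₂Q₃`. [this work] -/
theorem gladkovDefect_of_independent (p : ι → unitInterval) {G₁ G₂ G₃ : Set (Set ι)}
    (h12 : m⟦p, G₁ ∩ G₂⟧ = m⟦p, G₁⟧ * m⟦p, G₂⟧) (h13 : m⟦p, G₁ ∩ G₃⟧ = m⟦p, G₁⟧ * m⟦p, G₃⟧)
    (h23 : m⟦p, G₂ ∩ G₃⟧ = m⟦p, G₂⟧ * m⟦p, G₃⟧) (h123 : m⟦p, G₁ ∩ G₂ ∩ G₃⟧ = m⟦p, G₁⟧ * m⟦p, G₂⟧ * m⟦p, G₃⟧) :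
    gladkovDefect p (G₂ ∪ G₃) (G₁ ∪ G₃) (G₁ ∪ G₂) =
      m⟦p, G₁⟧ * m⟦p, G₂⟧ * m⟦p, G₃⟧ * ((1 - m⟦p, G₁⟧) * (1 - m⟦p, G₂⟧) * (1 - m⟦p, G₃⟧)) := by
  obtain ⟨ho, hα, hβ, hd⟩ := cells_of_independent p h12 h13 h23 h123
  set A := G₂ ∪ G₃; set B := G₁ ∪ G₃; set N := G₁ ∪ G₂
  have hsum := cells_sum_eq_one p A B N
  have hk : m⟦p, A ∩ B ∩ N⟧ = 1 - m⟦p, (A ∪ B)ᶜ⟧ - m⟦p, A \ B⟧ - m⟦p, B \ A⟧ - m⟦p, (A ∩ B) \ N⟧ := by linarith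
  simp only [gladkovDefect]
  rw [hk, ho, hα, hβ, hd]
  ring

/-- **The outside pays EXACTLY for independent events**: `e₃ = o·G`. [this work] -/
theorem outsidePays_of_independent (p : ι → unitInterval) {G₁ G₂ G₃ : Set (Set ι)}
    (h12 : m⟦p, G₁ ∩ G₂⟧ = m⟦p, G₁⟧ * m⟦p, G₂⟧) (h13 : m⟦p, G₁ ∩ G₃⟧ = m⟦p, G₁⟧ * m⟦p, G₃⟧)
    (h23 : m⟦p, G₂ ∩ G₃⟧ = m⟦p, G₂⟧ * m⟦p, G₃⟧) (h123 : m⟦p, G₁ ∩ G₂ ∩ G₃⟧ = m⟦p, G₁⟧ * m⟦p, G₂⟧ * m⟦p, G₃⟧) :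
    m⟦p, (G₂ ∪ G₃) \ (G₁ ∪ G₃)⟧ * m⟦p, (G₁ ∪ G₃) \ (G₂ ∪ G₃)⟧ * m⟦p, ((G₂ ∪ G₃) ∩ (G₁ ∪ G₃)) \ (G₁ ∪ G₂)⟧ =
      m⟦p, ((G₂ ∪ G₃) ∪ (G₁ ∪ G₃))ᶜ⟧ * gladkovDefect p (G₂ ∪ G₃) (G₁ ∪ G₃) (G₁ ∪ G₂) := by
  rw [gladkovDefect_of_independent p h12 h13 h23 h123]
  obtain ⟨ho, hα, hβ, hd⟩ := cells_of_independent p h12 h13 h23 h123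
  rw [ho, hα, hβ, hd]
  ring

/-- **Closed form of the one-payer functional for independent events**: `strongCubicMax = (max(κ,o) − o)·P₁P₂P₃Q₁Q₂Q₃`. [this work] -/
theorem strongCubicMax_of_independent (p : ι → unitInterval) {G₁ G₂ G₃ : Set (Set ι)}
    (h12 : m⟦p, G₁ ∩ G₂⟧ = m⟦p, G₁⟧ * m⟦p, G₂⟧) (h13 : m⟦p, G₁ ∩ G₃⟧ = m⟦p, G₁⟧ * m⟦p, G₃⟧)
    (h23 : m⟦p, G₂ ∩ G₃⟧ = m⟦p, G₂⟧ * m⟦p, G₃⟧) (h123 : m⟦p, G₁ ∩ G₂ ∩ G₃⟧ = m⟦p, G₁⟧ * m⟦p, G₂⟧ * m⟦p, G₃⟧) :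
    strongCubicMax p (G₂ ∪ G₃) (G₁ ∪ G₃) (G₁ ∪ G₂) =
      (max (m⟦p, (G₂ ∪ G₃) ∩ (G₁ ∪ G₃) ∩ (G₁ ∪ G₂)⟧) (m⟦p, ((G₂ ∪ G₃) ∪ (G₁ ∪ G₃))ᶜ⟧)
          - m⟦p, ((G₂ ∪ G₃) ∪ (G₁ ∪ G₃))ᶜ⟧) *
        (m⟦p, G₁⟧ * m⟦p, G₂⟧ * m⟦p, G₃⟧ * ((1 - m⟦p, G₁⟧) * (1 - m⟦p, G₂⟧) * (1 - m⟦p, G₃⟧))) := by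
  have hpay := outsidePays_of_independent p h12 h13 h23 h123
  rw [gladkovDefect_of_independent p h12 h13 h23 h123] at hpay
  simp only [strongCubicMax]
  rw [gladkovDefect_of_independent p h12 h13 h23 h123, hpay]
  ring

/-- **S₃^max for three independent events** (no monotonicity needed). [this work] -/
theorem strongCubicMax_nonneg_of_independent (p : ι → unitInterval) {G₁ G₂ G₃ : Set (Set ι)}
    (h12 : m⟦p, G₁ ∩ G₂⟧ = m⟦p, G₁⟧ * m⟦p, G₂⟧) (h13 : m⟦p, G₁ ∩ G₃⟧ = m⟦p, G₁⟧ * m⟦p, G₃⟧)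
    (h23 : m⟦p, G₂ ∩ G₃⟧ = m⟦p, G₂⟧ * m⟦p, G₃⟧) (h123 : m⟦p, G₁ ∩ G₂ ∩ G₃⟧ = m⟦p, G₁⟧ * m⟦p, G₂⟧ * m⟦p, G₃⟧) :
    0 ≤ strongCubicMax p (G₂ ∪ G₃) (G₁ ∪ G₃) (G₁ ∪ G₂) := by
  rw [strongCubicMax_of_independent p h12 h13 h23 h123]
  have hP1 := massInd_nonneg p G₁; have hP2 := massInd_nonneg p G₂; have hP3 := massInd_nonneg p G₃
  have hQ1 := sub_nonneg.2 (massInd_le_one p G₁); have hQ2 := sub_nonneg.2 (massInd_le_one p G₂)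
  have hQ3 := sub_nonneg.2 (massInd_le_one p G₃)
  exact mul_nonneg (sub_nonneg.2 (le_max_right _ _))
    (mul_nonneg (mul_nonneg (mul_nonneg hP1 hP2) hP3) (mul_nonneg (mul_nonneg hQ1 hQ2) hQ3))

/-- **Equality case**: for independent events with core no heavier than the outside (`κ ≤ o`), `strongCubicMax = 0` — the factor
`max(κ,o)` in `StrongCubicMaxNonneg` is attained. [this work] -/
theorem strongCubicMax_eq_zero_of_independent (p : ι → unitInterval) {G₁ G₂ G₃ : Set (Set ι)}
    (h12 : m⟦p, G₁ ∩ G₂⟧ = m⟦p, G₁⟧ * m⟦p, G₂⟧) (h13 : m⟦p, G₁ ∩ G₃⟧ = m⟦p, G₁⟧ * m⟦p, G₃⟧)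
    (h23 : m⟦p, G₂ ∩ G₃⟧ = m⟦p, G₂⟧ * m⟦p, G₃⟧) (h123 : m⟦p, G₁ ∩ G₂ ∩ G₃⟧ = m⟦p, G₁⟧ * m⟦p, G₂⟧ * m⟦p, G₃⟧)
    (hκo : m⟦p, (G₂ ∪ G₃) ∩ (G₁ ∪ G₃) ∩ (G₁ ∪ G₂)⟧ ≤ m⟦p, ((G₂ ∪ G₃) ∪ (G₁ ∪ G₃))ᶜ⟧) :
    strongCubicMax p (G₂ ∪ G₃) (G₁ ∪ G₃) (G₁ ∪ G₂) = 0 := by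
  rw [strongCubicMax_of_independent p h12 h13 h23 h123, max_eq_right hκo, sub_self, zero_mul]

end SahiDeepCore

end Summit.CriticalPhenomena.PercolationContinuityZ3.Theorems
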